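import Literature.NumberTheory.EllipticCurves.Fouquet2025.Assumption34TwistLocus
import Literature.NumberTheory.EllipticCurves.LocalTorsionMultiplicativeProofs
import Literature.NumberTheory.EllipticCurves.LeadingTermBSZOrdinaryProofs
import HarnessLib

/-!
# Fouquet 2025, Ass. 3.4 — PROVED bridge: at a multiplicative prime the `j`-form Kummer clause of `Assumption34TwistLocus.lean` IS the Tate-form clause of `Assumption34TateAt` (theorems only)

Topic `NumberTheory/EllipticCurves`, sub-directory `Fouquet2025` (namespace = path). Companion of
`Fouquet2025/Assumption34TwistLocus.lean` (typer seat `bsd-littype-07`, gen 4; cell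
`run/shared/lean/pub/bsd-littype/`, SHEETS-07 §F). THEOREMS ONLY: 0 definitions, 0 facts, 0 `sorry`.

WHAT IS PROVED. For a globally minimal elliptic `W/ℚ` and a prime `q` of MULTIPLICATIVE reduction
(integer model `E₀ = integralModelInt W`, `Δ_min = Δ(E₀)`, `v = v_q(Δ_min)`, `u_q = Δ_min / q^v`):
* `j(W) = c₄(E₀)³ / Δ_min` in `ℚ` (`j_eq_c₄_pow_div_minimalDiscriminantInt`, any `W`);
* `q ∤ c₄(E₀)³` (Silverman AEC VII.5.1(b), from the tree's
  `LocalTorsionMult.dvd_Δ_and_not_dvd_c₄_integralModelInt_of_mult`), hence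
  `v_q(j) = −v_q(Δ_min)` (`padicValRat_j_of_hasMultiplicativeReductionAtPrime`) and
  `p ∣ v_q(j) ↔ p ∣ v_q(Δ_min)` — the «`W[p]` unramified at `q`» test of the two files agree;
* (`q ∤ u_q`, private) and `jUnitPart q W = c₄(E₀)³ / u_q` (`jUnitPart_eq_of_hasMultiplicativeReductionAtPrime`);
* in `ZMod q`: `(¬ ∃ x, x^p = jUnitPart) ↔ (¬ ∃ x, x^p · c₄³ = u_q)`
  (`kummer_jUnitPart_iff_tate`): the twist-invariant clause 5(b) of `Assumption34TwistAt` and the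
  clause of `Assumption34TateAt` are the SAME condition on the primes where both make sense; and the
  whole of `Assumption34TateAt p W` restated in `j`-form (`assumption34TateAt_iff_jForm`).
* the LITERAL primes are twist-unramified (witness `d = 1`, `W.quadraticTwist 1 ≅ W`): a good `q`
  (`isTwistUnramifiedAt_of_hasGoodReductionAtPrime`) and a multiplicative `q` with `p ∣ v_q(Δ_min)`
  (`isTwistUnramifiedAt_of_hasMultiplicativeReductionAtPrime`) satisfy `IsTwistUnramifiedAt p W q`.
So `Assumption34At p W G = Assumption34TateAt p W ∧ Assumption34TwistAt p W G` is ONE uniform test —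
«at every prime `q ≠ p` of `N_W` with `W[p]|I_q` scalar: `q ≠ 2`, and at `q ≡ 1 (mod p)` the unit part
of `j` of each potentially multiplicative member of the pair is not a `p`-th power mod `q`» — read on
the multiplicative primes (sibling file, literal reading) and on the additive twist-unramified primes
(twist locus). Nothing here asserts anything about Fouquet's theorem; see the module docstring of
`Assumption34TwistLocus.lean` for the located quantifier issue (OPEN-QUESTIONS-07 F12).

## References
* [Fouquet2025EquivariantTNC] Ass. 3.4 (5)(b) (p. 23), pp. 22–24.
* [Silverman1994] ATAEC Lemma V.5.1 (`j = 1/𝓆 + 744 + …`), Thm V.5.3.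
* [SilvermanAEC2009] AEC Prop. VII.5.1(b) (multiplicative ⟺ `v(Δ) > 0`, `v(c₄) = 0` on a minimal
  model), VII.5.5.
* Tree: `Fouquet2025/CongruenceTransportAnyReduction.lean` (`Assumption34TateAt`),
  `Fouquet2025/Assumption34TwistLocus.lean` (`jUnitPart`, `IsTwistUnramifiedAt`,
  `Assumption34TwistAt`, `Assumption34At`), `LocalTorsionMultiplicativeProofs.lean`,
  `GlobalMinimalModel.lean` (`integralModelInt`, `minimalDiscriminantInt`, `map_integralModelInt`,
  `cast_minimalDiscriminantInt`).
-/

noncomputable section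

open scoped Classical

namespace Literature.NumberTheory.EllipticCurves.Fouquet2025

open _root_.WeierstrassCurve Literature.NumberTheory.EllipticCurves

variable (W : WeierstrassCurve ℚ) [W.IsElliptic] [W.IsGloballyMinimal] (q : ℕ) [hq : Fact q.Prime]

omit hq in
/-- `j(W) = c₄(E₀)³ / Δ_min` in `ℚ`, `E₀ = integralModelInt W` (Silverman AEC III.1: `j = c₄³/Δ`,
read on the integer model through `map_integralModelInt`). [cite: SilvermanAEC2009, III.1] -/
theorem j_eq_c₄_pow_div_minimalDiscriminantInt :
    W.j = ((W.integralModelInt.c₄ ^ 3 : ℤ) : ℚ) / (W.minimalDiscriminantInt : ℚ) := by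
  have hc : W.c₄ = ((W.integralModelInt.c₄ : ℤ) : ℚ) := by
    conv_lhs => rw [← map_integralModelInt W]
    rw [map_c₄, eq_intCast]
  have hΔ : W.Δ = (W.minimalDiscriminantInt : ℚ) := (cast_minimalDiscriminantInt W).symm
  rw [WeierstrassCurve.j, Units.val_inv_eq_inv_val, coe_Δ', hΔ, hc, Int.cast_pow, div_eq_inv_mul]

/-- At a multiplicative prime `q`, `q ∤ c₄(E₀)³` (AEC VII.5.1(b): `q ∤ c₄(E₀)`, and `q` is prime).
[cite: SilvermanAEC2009, VII.5 Prop. 5.1(b)] -/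
theorem not_dvd_c₄_pow_of_hasMultiplicativeReductionAtPrime
    (hmult : W.HasMultiplicativeReductionAtPrime q) :
    ¬ (q : ℤ) ∣ W.integralModelInt.c₄ ^ 3 := fun h =>
  (LocalTorsionMult.dvd_Δ_and_not_dvd_c₄_integralModelInt_of_mult W q hmult).2
    ((Nat.prime_iff_prime_int.mp hq.out).dvd_of_dvd_pow h)

/-- **At a multiplicative prime `q`, `v_q(j) = −v_q(Δ_min)`** (`j = c₄³/Δ_min` with `q ∤ c₄`).
[cite: SilvermanAEC2009, VII.5 Prop. 5.1(b)] [cite: Silverman1994, Lemma V.5.1] -/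
theorem padicValRat_j_of_hasMultiplicativeReductionAtPrime
    (hmult : W.HasMultiplicativeReductionAtPrime q) :
    padicValRat q W.j = -(padicValInt q W.minimalDiscriminantInt : ℤ) := by
  have hc3 := not_dvd_c₄_pow_of_hasMultiplicativeReductionAtPrime W q hmult
  have hc0 : (W.integralModelInt.c₄ ^ 3 : ℤ) ≠ 0 := fun h => hc3 (h ▸ dvd_zero _)
  have hΔ0 : W.minimalDiscriminantInt ≠ 0 := minimalDiscriminantInt_ne_zero W
  rw [j_eq_c₄_pow_div_minimalDiscriminantInt W,
    padicValRat.div (by exact_mod_cast hc0) (by exact_mod_cast hΔ0),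
    padicValRat.of_int, padicValRat.of_int, padicValInt.eq_zero_of_not_dvd hc3]
  simp

/-- At a multiplicative prime `q`: the two files' «`W[p]` unramified at `q`» tests agree —
`p ∣ v_q(j)` (`IsTwistUnramifiedAt`, multiplicative branch) iff `p ∣ v_q(Δ_min)`
(`Assumption34TateAt`). [cite: Silverman1994, Thm V.5.3, Lemma V.5.1] -/
theorem intCast_dvd_padicValRat_j_iff_of_hasMultiplicativeReductionAtPrime (p : ℕ)
    (hmult : W.HasMultiplicativeReductionAtPrime q) :
    (p : ℤ) ∣ padicValRat q W.j ↔ p ∣ padicValInt q W.minimalDiscriminantInt := by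
  rw [padicValRat_j_of_hasMultiplicativeReductionAtPrime W q hmult, Int.dvd_neg,
    Int.natCast_dvd_natCast]

omit [W.IsElliptic] hq in
/-- The exact quotient: `Δ_min = q^{v_q(Δ_min)} · (Δ_min / q^{v_q(Δ_min)})` (private helper). [folklore] -/
private theorem minimalDiscriminantInt_eq_pow_mul_div :
    W.minimalDiscriminantInt =
      (q : ℤ) ^ padicValInt q W.minimalDiscriminantInt *
        (W.minimalDiscriminantInt / (q : ℤ) ^ padicValInt q W.minimalDiscriminantInt) :=
  (Int.mul_ediv_cancel' (padicValInt_dvd _)).symm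

/-- `q ∤ u_q := Δ_min / q^{v_q(Δ_min)}` (the unit part of the minimal discriminant is a `q`-unit;
private helper). [folklore] -/
private theorem not_dvd_minimalDiscriminantInt_div :
    ¬ (q : ℤ) ∣ W.minimalDiscriminantInt / (q : ℤ) ^ padicValInt q W.minimalDiscriminantInt := by
  rintro ⟨w, hw⟩
  set v := padicValInt q W.minimalDiscriminantInt with hv
  have hΔ : (q : ℤ) ^ (v + 1) ∣ W.minimalDiscriminantInt :=
    ⟨w, by rw [minimalDiscriminantInt_eq_pow_mul_div W q, ← hv, hw, pow_succ, mul_assoc]⟩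
  rcases (padicValInt_dvd_iff (v + 1) W.minimalDiscriminantInt).mp hΔ with h0 | hle
  · exact minimalDiscriminantInt_ne_zero W h0
  · rw [← hv] at hle
    omega

/-- **At a multiplicative prime `q`, `jUnitPart q W = c₄(E₀)³ / u_q`** with
`u_q = Δ_min / q^{v_q(Δ_min)}` — the identity behind the docstring of `jUnitPart`
(unit part of `j` = `c₄³/u_q`). [cite: Silverman1994, Lemma V.5.1] [cite: SilvermanAEC2009, VII.5 Prop. 5.1(b)] -/
theorem jUnitPart_eq_of_hasMultiplicativeReductionAtPrime
    (hmult : W.HasMultiplicativeReductionAtPrime q) :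
    jUnitPart q W = ((W.integralModelInt.c₄ ^ 3 : ℤ) : ℚ) /
      ((W.minimalDiscriminantInt / (q : ℤ) ^ padicValInt q W.minimalDiscriminantInt : ℤ) : ℚ) := by
  set v := padicValInt q W.minimalDiscriminantInt with hv
  set u := W.minimalDiscriminantInt / (q : ℤ) ^ v with hu
  have hΔu : W.minimalDiscriminantInt = (q : ℤ) ^ v * u := minimalDiscriminantInt_eq_pow_mul_div W q
  have hu0 : u ≠ 0 := fun h => minimalDiscriminantInt_ne_zero W (by rw [hΔu, h, mul_zero])
  have hq0 : (q : ℚ) ≠ 0 := by exact_mod_cast hq.out.ne_zero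
  have hu0' : (u : ℚ) ≠ 0 := by exact_mod_cast hu0
  rw [jUnitPart, padicValRat_j_of_hasMultiplicativeReductionAtPrime W q hmult, neg_neg, ← hv,
    j_eq_c₄_pow_div_minimalDiscriminantInt W, hΔu, zpow_natCast]
  push_cast
  field_simp

/-- **Bridge (proved): at a multiplicative prime `q` the `j`-form Kummer clause of
`Assumption34TwistAt` IS the Tate-form clause of `Assumption34TateAt`** — in `ZMod q`,
`(¬ ∃ x, x^p = jUnitPart q W) ↔ (¬ ∃ x, x^p · c₄(E₀)³ = u_q)`; both `c₄(E₀)³` and `u_q` are non-zero in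
`ZMod q`, and `jUnitPart = c₄³/u_q` there, so `x ↦ x⁻¹` exchanges the two witnesses (any `p : ℕ`).
[cite: Fouquet2025EquivariantTNC, Ass. 3.4 (5)(b) (p. 23)] [cite: Silverman1994, Lemma V.5.1, Thm V.5.3] -/
theorem kummer_jUnitPart_iff_tate (p : ℕ) (hmult : W.HasMultiplicativeReductionAtPrime q) :
    (¬ ∃ x : ZMod q, x ^ p = ((jUnitPart q W : ℚ) : ZMod q)) ↔
      ¬ ∃ x : ZMod q, x ^ p * ((W.integralModelInt.c₄ ^ 3 : ℤ) : ZMod q) =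
        ((W.minimalDiscriminantInt / (q : ℤ) ^ padicValInt q W.minimalDiscriminantInt : ℤ) : ZMod q) := by
  rw [not_iff_not]
  set c : ℤ := W.integralModelInt.c₄ ^ 3 with hcdef
  set u : ℤ := W.minimalDiscriminantInt / (q : ℤ) ^ padicValInt q W.minimalDiscriminantInt with hudef
  have hc : (c : ZMod q) ≠ 0 := by
    rw [Ne, ZMod.intCast_zmod_eq_zero_iff_dvd]
    exact not_dvd_c₄_pow_of_hasMultiplicativeReductionAtPrime W q hmult
  have hu : (u : ZMod q) ≠ 0 := by
    rw [Ne, ZMod.intCast_zmod_eq_zero_iff_dvd]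
    exact not_dvd_minimalDiscriminantInt_div W q
  have hcast : ((jUnitPart q W : ℚ) : ZMod q) = (c : ZMod q) / (u : ZMod q) := by
    rw [jUnitPart_eq_of_hasMultiplicativeReductionAtPrime W q hmult, ← hcdef, ← hudef,
      Rat.intCast_div_eq_divInt, Rat.cast_divInt_of_ne_zero _ hu]
  rw [hcast]
  constructor
  · rintro ⟨x, hx⟩
    refine ⟨x⁻¹, ?_⟩
    rw [inv_pow, hx, inv_div, div_mul_cancel₀ _ hc]
  · rintro ⟨y, hy⟩
    have hyp : y ^ p ≠ 0 := by
      intro h0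
      rw [h0, zero_mul] at hy
      exact hu hy.symm
    refine ⟨y⁻¹, ?_⟩
    rw [inv_pow, eq_div_iff hu, ← hy, inv_mul_cancel_left₀ hyp]

/-- **`Assumption34TateAt` in `j`-form (proved equivalent):** the sibling file's Ass. 3.4 on the
literal Tate primes reads, prime by prime, exactly like `Assumption34TwistAt` — «for every
multiplicative `q ≠ p` with `p ∣ v_q(j)`: `q ≠ 2`, and `q ≡ 1 (mod p)` ⇒ `jUnitPart q W` is not a
`p`-th power in `ZMod q`». Hence `Assumption34At` is one uniform test on the multiplicative and the
additive twist-unramified primes. [cite: Fouquet2025EquivariantTNC, Ass. 3.4 (pp. 22–23)] -/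
theorem assumption34TateAt_iff_jForm (p : ℕ) :
    Assumption34TateAt p W ↔
      ∀ (q : ℕ) [Fact q.Prime], q ≠ p → W.HasMultiplicativeReductionAtPrime q →
        (p : ℤ) ∣ padicValRat q W.j →
          q ≠ 2 ∧ (q % p = 1 → ¬ ∃ x : ZMod q, x ^ p = ((jUnitPart q W : ℚ) : ZMod q)) := by
  constructor
  · intro h r _ hrp hmult hdvd
    have hv : p ∣ padicValInt r W.minimalDiscriminantInt :=
      (intCast_dvd_padicValRat_j_iff_of_hasMultiplicativeReductionAtPrime W r p hmult).mp hdvd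
    obtain ⟨h2, hk⟩ := h r hrp hmult hv
    exact ⟨h2, fun h1 => (kummer_jUnitPart_iff_tate W r p hmult).mpr (hk h1)⟩
  · intro h r _ hrp hmult hv
    have hdvd : (p : ℤ) ∣ padicValRat r W.j :=
      (intCast_dvd_padicValRat_j_iff_of_hasMultiplicativeReductionAtPrime W r p hmult).mpr hv
    obtain ⟨h2, hk⟩ := h r hrp hmult hdvd
    exact ⟨h2, fun h1 => (kummer_jUnitPart_iff_tate W r p hmult).mp (hk h1)⟩

/-! ## The literal primes are twist-unramified (witness `d = 1`; appended, gen 4) -/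

omit [W.IsGloballyMinimal] in
/-- A prime of GOOD reduction is twist-unramified (witness `d = 1`: `W.quadraticTwist 1 = C • W`,
`exists_variableChange_quadraticTwist_one`, and good reduction is an isomorphism invariant,
`BSZLemma17.hasGoodReductionAtPrime_smul_iff`). [cite: SilvermanAEC2009, VII.5 Prop. 5.1, X.5] -/
theorem isTwistUnramifiedAt_of_hasGoodReductionAtPrime (p : ℕ) (hgood : W.HasGoodReductionAtPrime q) :
    IsTwistUnramifiedAt p W q := by
  obtain ⟨C, hC⟩ := exists_variableChange_quadraticTwist_one W
  refine ⟨1, one_ne_zero, Or.inl ?_⟩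
  rw [← hC, BSZLemma17.hasGoodReductionAtPrime_smul_iff]
  exact hgood

/-- A prime of MULTIPLICATIVE reduction with `p ∣ v_q(Δ_min)` — a Tate prime of `Assumption34TateAt`,
i.e. `W[p]` unramified at `q` — is twist-unramified (witness `d = 1`; multiplicative reduction is an
isomorphism invariant, `BSZLemma17.hasMultiplicativeReductionAtPrime_smul_iff`, and
`p ∣ v_q(j) ↔ p ∣ v_q(Δ_min)` there). [cite: SilvermanAEC2009, VII.5 Prop. 5.1] [cite: Silverman1994, Thm V.5.3] -/
theorem isTwistUnramifiedAt_of_hasMultiplicativeReductionAtPrime (p : ℕ)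
    (hmult : W.HasMultiplicativeReductionAtPrime q) (hv : p ∣ padicValInt q W.minimalDiscriminantInt) :
    IsTwistUnramifiedAt p W q := by
  obtain ⟨C, hC⟩ := exists_variableChange_quadraticTwist_one W
  refine ⟨1, one_ne_zero, Or.inr ⟨?_,
    (intCast_dvd_padicValRat_j_iff_of_hasMultiplicativeReductionAtPrime W q p hmult).mpr hv⟩⟩
  rw [← hC, BSZLemma17.hasMultiplicativeReductionAtPrime_smul_iff]
  exact hmult

end Literature.NumberTheory.EllipticCurves.Fouquet2025

end
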